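import Summits.QuantumFields.BalabanUV.T4Continuum.Support.RegionTwoZoneLocal
import Summits.QuantumFields.BalabanUV.T4Continuum.Support.RegionLocalComponentwise

/-!
# T⁴ programme, spine node NE2 (U1a), sub-row Δ1 «NE2⁰-Dirichlet» — THE TWO-ZONE LOCAL OPERATOR IS COMPONENTWISE ON OUTER REGIONS WITHOUT
# RE-ENTRANT CONTACT (in particular `S₀ = ⊤`): `localTZ = ⊕_ν (localTZ)_ν`, and so is its resolvent

NE2 formalisation swarm `b2b-balaban-t4-ne2-formalise-*`, LEAF PROVER 07 (gen 11), file 2 of the supplier brick «Δ1-LOC-COMPONENTWISE»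
(file 1 `Support/RegionLocalComponentwise`: the single-zone statement for the owner's `regionDeltaLoc`), on leaf-05-g10's
`Support/RegionTwoZoneLocal` (`localTZ S₀ S₁ = regionDeltaLoc S₀ + a n²·selCᴴselC`, `isUnit_det_localTZ`).  The collar mass is a DIAGONAL
matrix on the star bonds, so the two-zone local operator inherits file 1 verbatim:

 * `selC_gram_apply_eq_zero_of_ne` (the collar mass matrix `selCᴴselC` is diagonal);
 * **`localTZ_apply_eq_zero_of_ne (hH : AtMostOneNeighbour n M S₀) : b.2 ≠ b′.2 → localTZ b b′ = 0`**, `localTZ_mul_compP`,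
   `form_localTZ_eq_sum`, **`localTZ_inv_mul_compP`** (given `IsUnit localTZ.det`);
 * at `S₀ = ⊤` (the numerics' TZ-box / TZ-lshape / TZ-hole geometries) with NO geometric hypothesis on the inner region `S₁`:
   **`localTZ_top_inv_mul_compP (hn : 1 ≤ n) (ha : 0 < a)`** — the determinant is a unit by leaf-05-g10's `isUnit_det_localTZ`
   (`Collared` holds trivially inside the whole torus).

This is the structural reason recorded in `t4/T4-EST-NE2-D1-COLLAR.md` / `t4/T4-EST-NE2-D1-COLLAR-STRUCT.md` §4 (d) for the scalar
(soft-Dirichlet) behaviour of the two-zone LOCAL tower: at `S₀ = ⊤` component `ν` of `localTZ⁻¹ f` depends on component `ν` of `f` only.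

HONEST FRAMING (T4-DAG p. 1).  Model level (`U = 1`, two zones, ONE averaging scale, finite torus); [folklore] algebra over landed modules;
no estimate, no rate, nothing printed asserted; on outer regions WITH re-entrant contact `localTZ` is NOT componentwise; NE2 (U1a) NOT proved;
spine PROVED 0/9 unchanged; NOT [B9] (3.16)/(3.23)–(3.27) as printed; NOT infinite volume / mass gap / Clay.  HONEST DEPENDENCY: continuum
YM on T⁴ ⇐ BetaPertH ∧ nine spine estimates (0/9 proved); BetaPertH ⇐ (D1) ∧ (D4) ∧ CAP+tail; G-an2-4 gates asym, D1 and NE2/3/4.  No `sorry`.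
-/

noncomputable section

open scoped BigOperators ComplexConjugate Matrix
open Finset

namespace Summit.QuantumFields.BalabanUV.T4Continuum.RegionTwoZoneComponentwise

open Literature.MathematicalPhysics.QuantumFieldTheory.Balaban1983to89.B5Prop11Plancherel (Tor fine unitVec)
open Summit.QuantumFields.BalabanUV.T4Continuum
open Summit.QuantumFields.BalabanUV.T4Continuum.RegionGaugeFixedVector (starReg)
open Summit.QuantumFields.BalabanUV.T4Continuum.RegionGaugeTwoZone (collar selC)
open Summit.QuantumFields.BalabanUV.T4Continuum.RegionStarBoundaryCharges (AtMostOneNeighbour)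
open Summit.QuantumFields.BalabanUV.T4Continuum.RegionTwoZoneLocal (Collared localTZ localTZ_eq isUnit_det_localTZ)
open Summit.QuantumFields.BalabanUV.T4Continuum.RegionLocalComponentwise (compP sdir regionDeltaLoc_apply_eq_zero_of_ne
  mul_compP_eq_of_apply_eq_zero form_eq_sum_compP inv_mul_compP_of_apply_eq_zero atMostOneNeighbour_top)
open Summit.QuantumFields.BalabanUV.Beta.GAN24.DirichletBoxTrace (blockReg)

variable {d : ℕ} (n : ℕ) [NeZero n] (M : Fin d → ℕ) [hM : ∀ μ, NeZero (M μ)] (a : ℝ) (S₀ S₁ : Tor M → Prop)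
  [DecidablePred S₀] [DecidablePred S₁]

/-- the collar mass matrix `selCᴴselC` is diagonal. [folklore] -/
theorem selC_gram_apply_eq_zero_of_ne {b b' : {b // starReg n M S₀ b}} (h : b ≠ b') :
    ((selC n M S₀ S₁)ᴴ * selC n M S₀ S₁) b b' = 0 := by
  rw [Matrix.mul_apply]
  refine Finset.sum_eq_zero fun c _ => ?_
  rw [Matrix.conjTranspose_apply]
  unfold selC
  by_cases hc : (c : Tor (fine n M) × Fin d) = (b' : Tor (fine n M) × Fin d)
  · have hb : (c : Tor (fine n M) × Fin d) ≠ (b : Tor (fine n M) × Fin d) := by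
      rw [hc]; exact fun e => h (Subtype.ext e).symm
    rw [if_neg hb, star_zero, zero_mul]
  · rw [if_neg hc, mul_zero]

/-- **`localTZ` HAS NO CROSS-DIRECTION ENTRIES on an outer region without re-entrant contact.** [folklore] -/
theorem localTZ_apply_eq_zero_of_ne (hH : AtMostOneNeighbour n M S₀) {b b' : {b // starReg n M S₀ b}} (h : b.1.2 ≠ b'.1.2) :
    localTZ n M a S₀ S₁ b b' = 0 := by
  have hne : b ≠ b' := fun e => h (congrArg (fun b : {b // starReg n M S₀ b} => b.1.2) e)
  have hs : ((selC n M S₀ S₁)ᴴ * selC n M S₀ S₁) b b' = 0 := selC_gram_apply_eq_zero_of_ne n M S₀ S₁ hne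
  rw [localTZ_eq, Matrix.add_apply, regionDeltaLoc_apply_eq_zero_of_ne n M a S₀ hH h, zero_add, Matrix.smul_apply, hs, smul_zero]

/-- `localTZ` commutes with the direction projections (H1 outer regions). [folklore] -/
theorem localTZ_mul_compP (hH : AtMostOneNeighbour n M S₀) (ν : Fin d) :
    localTZ n M a S₀ S₁ * compP (sdir n M S₀) ν = compP (sdir n M S₀) ν * localTZ n M a S₀ S₁ :=
  mul_compP_eq_of_apply_eq_zero (sdir n M S₀) (fun _ _ h => localTZ_apply_eq_zero_of_ne n M a S₀ S₁ hH h) ν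

/-- the form of `localTZ` splits direction by direction (H1 outer regions). [folklore] -/
theorem form_localTZ_eq_sum (hH : AtMostOneNeighbour n M S₀) (A : {b // starReg n M S₀ b} → ℂ) :
    star A ⬝ᵥ (localTZ n M a S₀ S₁ *ᵥ A)
      = ∑ ν, star (compP (sdir n M S₀) ν *ᵥ A) ⬝ᵥ (localTZ n M a S₀ S₁ *ᵥ (compP (sdir n M S₀) ν *ᵥ A)) :=
  form_eq_sum_compP (sdir n M S₀) (fun _ _ h => localTZ_apply_eq_zero_of_ne n M a S₀ S₁ hH h) A

/-- **THE TWO-ZONE LOCAL RESOLVENT IS COMPONENTWISE** (H1 outer regions, `localTZ` invertible). [folklore] -/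
theorem localTZ_inv_mul_compP (hH : AtMostOneNeighbour n M S₀) (hU : IsUnit (localTZ n M a S₀ S₁).det) (ν : Fin d) :
    (localTZ n M a S₀ S₁)⁻¹ * compP (sdir n M S₀) ν = compP (sdir n M S₀) ν * (localTZ n M a S₀ S₁)⁻¹ :=
  inv_mul_compP_of_apply_eq_zero (sdir n M S₀) (fun _ _ h => localTZ_apply_eq_zero_of_ne n M a S₀ S₁ hH h) hU ν

omit [DecidablePred S₁] in
/-- inside the whole torus every inner region is collared. [folklore] -/
theorem collared_top : Collared n M (fun _ : Tor M => True) S₁ := by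
  intro x _ ν
  exact ⟨trivial, trivial⟩

/-- **AT `S₀ = ⊤` THE TWO-ZONE LOCAL RESOLVENT IS COMPONENTWISE, FOR EVERY INNER REGION** (`n ≥ 1`, `a > 0`; no hypothesis on `S₁`).
[folklore] -/
theorem localTZ_top_inv_mul_compP (hn : 1 ≤ n) (ha : 0 < a) (ν : Fin d) :
    (localTZ n M a (fun _ : Tor M => True) S₁)⁻¹ * compP (sdir n M (fun _ : Tor M => True)) ν
      = compP (sdir n M (fun _ : Tor M => True)) ν * (localTZ n M a (fun _ : Tor M => True) S₁)⁻¹ :=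
  localTZ_inv_mul_compP n M a _ S₁ (atMostOneNeighbour_top n M)
    (isUnit_det_localTZ n M a _ S₁ (fun _ _ => trivial) (collared_top n M S₁) hn ha) ν

end Summit.QuantumFields.BalabanUV.T4Continuum.RegionTwoZoneComponentwise

end
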